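import Summits.CriticalPhenomena.PercolationContinuityZ3.Theorems.Transplant.SiteVdBHKRestrict
import HarnessLib

/-!
# SITE percolation given `{s ↮ X}` — II: site Theorem 1.1 (functional form) by induction on the vertex set

Part II of three: `SiteBHK.core` (imports Part I `SiteVdBHKRestrict`).


builds on p205010 (kernel theorem, internal audit signed; external expert review pending).

van den Berg–Häggström–Kahn (Random Structures Algorithms 29 (2006), Thms 1.1–1.3) prove, for
BOND percolation, that the open cluster `C_s` is positively associated conditionally on
`R_X = {s ↮ X}`; the tree proves it in `ConditionalPositiveAssociationProofs.lean`
(`BHK2006.core`, `BHK2006_clusterConditionalPositiveAssociation_holds`).  The printed theorem does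
NOT cover site percolation ("Consider ordinary bond percolation", §1 p. 3), and site percolation is
not a special case of bond percolation; the p205010 chain uses Thm 1.3 at its links (B0) and (C2)
(CHAIN-READ §3.7, §4.4), so a site re-run of the chain needs the SITE theorem.  This file proves it
(OUR theorem; the census seat's sketch `run/shared/lean/prim/bschramm/CENSUS.md` §7b):

**Setting (convention A).** `V` finite, `Γ : SimpleGraph V`, vertex weights `q : V → [0,1]`, law
`prodBernoulli q` on `Set V` (the open vertices); `u ↔ v` iff `u, v` are open and joined by a path
of open vertices; `C_s = siteCluster Γ ω s` (`= ∅` if `s` is closed); `R_X = {∀ x ∈ X, x ∉ C_s}`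
(so `s ∈ X` is allowed and then `R_X = {s closed}`).

* `SiteBHK.core` — **site Thm 1.1, functional form**, for percolation restricted to a vertex set
  `U`: for `F, G ≥ 0` increasing,
  `E[F(C) 1_{R_X}] E[G(C) 1_{R_Y}] ≤ E[F(C) G(C) 1_{R_{X∩Y}}] P(R_{X∪Y})`.
  PROOF = BHK's induction on the vertex set with ONE substitution: instead of conditioning on the
  set of vertices joined to `Z = X ∩ Y` by an open EDGE, condition on the STATES OF THE VERTICES OF
  `Z` (a block of coordinates of `ω : Set V`, product law — `BHK2006.blockFubini`); given them, with
  `S` = the open vertices of `Z` and `N(S)` = their neighbours in `U ∖ Z`,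
  `{s ↮ W in U} = {s ↮ (W ∖ Z) ∪ N(S) in U ∖ Z}` for `W ⊇ Z` and on this event the cluster of `s`
  in `U` is its cluster in `U ∖ Z` (`SiteBHK.mem_sD_iff_restrict`, `SiteBHK.sC_restrict`: a path
  from `s` first enters `Z` at an OPEN vertex, from a neighbour reached inside `U ∖ Z`; closed
  vertices of `Z` block).  `N(S ∩ T) ⊆ N(S) ∩ N(T)`, `N(S ∪ T) = N(S) ∪ N(T)`, and the
  Ahlswede–Daykin step is verbatim (`four_functions_theorem_univ` with the product-weight lattice
  identity × the induction hypothesis).  `Z = ∅` is Harris twice; the degenerate placements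
  `s ∈ X` / `s ∈ Y` (where `R = {s closed}` and `C = ∅`) hold pointwise.
* `SiteBHK.siteClusterCondPosAssoc` — **site Thm 1.3**: for `F, G` monotone functions of the site
  cluster, `(∫_{R_X} F(C_s))(∫_{R_X} G(C_s)) ≤ P(R_X) ∫_{R_X} F(C_s) G(C_s)` under `prodBernoulli q`
  (denominator-free, exactly the shape of the bond fact `BHK2006_clusterConditionalPositiveAssociation`,
  with NO hypothesis `s ∉ X`).

Exact census (census seat, CENSUS.md §4, rows BHK13/VDBK*): 0 violations on n ≤ 5 exhaustive
(9.8 M instances) before this proof was written.  Support file (`--supports stmt-CriticalPhenomena-4575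
--as helper`); sorry-free, standard axioms; no new `Prop` definitions.
[cite: VandenbergHaggstromKahn2005, Thms. 1.1–1.3 (pp. 3–6)] [cite: GrimmettPercolation1999, §1.6 p. 24]
-/

noncomputable section

namespace Summit.CriticalPhenomena.PercolationContinuityZ3.Theorems.Transplant

namespace SiteBHK

open MeasureTheory unitInterval
open Literature.Probability.LatticeModels (prodBernoulli)
open Literature.Probability.Percolation
open Literature.Probability.Percolation.BHK2006 (weight weight_nonneg weight_inter_mul_union blockFubini
  sum_affine harris harris_mono_anti harris_anti_anti sum_ind_mono sum_ind_nonneg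
  integral_prodBernoulli_eq_sum ind_le_one ind_mono ind_inter)
open scoped Classical
open DecisionTree (ind ind_of_mem ind_of_not_mem ind_nonneg)

variable {V : Type*} (Γ : SimpleGraph V)

variable {Γ}
variable [Fintype V]

/-! ### Site Theorem 1.1 (functional form) by induction on the vertex set -/

/-- **Site Thm 1.1, functional form, inside `U`.**  For `s ∈ U`, `X, Y ⊆ U`, `F, G ≥ 0` increasing,
`E[F(C) 1{s↮X}] · E[G(C) 1{s↮Y}] ≤ E[F(C) G(C) 1{s ↮ X∩Y}] · P(s ↮ X∪Y)` (site model, convention A;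
no hypothesis `s ∉ X ∪ Y`). [cite: VandenbergHaggstromKahn2005, Thm. 1.1 (pp. 3–5)] -/
theorem core (q : V → ℝ) (hq0 : ∀ v, 0 ≤ q v) (hq1 : ∀ v, q v ≤ 1) (hm : ∑ ω, weight q ω = 1)
    (U : Finset V) :
    ∀ (s : V), s ∈ U → ∀ (X Y : Set V), X ⊆ ↑U → Y ⊆ ↑U →
    ∀ (F G : Set V → ℝ), Monotone F → Monotone G → (∀ a, 0 ≤ F a) → (∀ a, 0 ≤ G a) →
    (∑ ω, weight q ω * (F (sC Γ U s ω) * ind (sD Γ U s X) ω)) *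
      (∑ ω, weight q ω * (G (sC Γ U s ω) * ind (sD Γ U s Y) ω)) ≤
    (∑ ω, weight q ω * (F (sC Γ U s ω) * G (sC Γ U s ω) * ind (sD Γ U s (X ∩ Y)) ω)) *
      (∑ ω, weight q ω * ind (sD Γ U s (X ∪ Y)) ω) := by
  induction U using Finset.strongInduction with
  | H U ih =>
  intro s hsU X Y hXU hYU F G hF hG hF0 hG0
  have hwn := fun ω => weight_nonneg hq0 hq1 ω
  -- degenerate placements `s ∈ X` / `s ∈ Y`: there `R = {s closed}` and `C = ∅`, pointwise
  by_cases hsX : s ∈ X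
  · have hXY : ∀ ω, ind (sD Γ U s (X ∪ Y)) ω = ind (sD Γ U s X) ω := fun ω => by
      by_cases h : s ∈ ω
      · rw [ind_of_not_mem (fun h' => (mem_sD_iff_notMem hsU (Or.inl hsX) ω).1 h' h),
          ind_of_not_mem (fun h' => (mem_sD_iff_notMem hsU hsX ω).1 h' h)]
      · rw [ind_of_mem ((mem_sD_iff_notMem hsU (Or.inl hsX) ω).2 h),
          ind_of_mem ((mem_sD_iff_notMem hsU hsX ω).2 h)]
    have hF1 : ∀ ω, F (sC Γ U s ω) * ind (sD Γ U s X) ω = F ∅ * ind (sD Γ U s X) ω := fun ω => by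
      by_cases h : s ∈ ω
      · rw [ind_of_not_mem (fun h' => (mem_sD_iff_notMem hsU hsX ω).1 h' h), mul_zero, mul_zero]
      · rw [sC_eq_empty_of_notMem h]
    have hpt : ∀ ω, F ∅ * (G (sC Γ U s ω) * ind (sD Γ U s Y) ω) ≤
        F (sC Γ U s ω) * G (sC Γ U s ω) * ind (sD Γ U s (X ∩ Y)) ω := fun ω => by
      have h1 : F ∅ ≤ F (sC Γ U s ω) := hF (Set.empty_subset _)
      have h2 : ind (sD Γ U s Y) ω ≤ ind (sD Γ U s (X ∩ Y)) ω :=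
        ind_mono (sD_antitone Set.inter_subset_right) ω
      calc F ∅ * (G (sC Γ U s ω) * ind (sD Γ U s Y) ω)
          ≤ F (sC Γ U s ω) * (G (sC Γ U s ω) * ind (sD Γ U s (X ∩ Y)) ω) :=
            mul_le_mul h1 (mul_le_mul_of_nonneg_left h2 (hG0 _))
              (mul_nonneg (hG0 _) (ind_nonneg _ _)) (hF0 _)
        _ = _ := by ring
    simp_rw [hXY, hF1]
    have hsum : F ∅ * ∑ ω, weight q ω * (G (sC Γ U s ω) * ind (sD Γ U s Y) ω) ≤
        ∑ ω, weight q ω * (F (sC Γ U s ω) * G (sC Γ U s ω) * ind (sD Γ U s (X ∩ Y)) ω) := by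
      rw [Finset.mul_sum]
      refine Finset.sum_le_sum fun ω _ => ?_
      rw [mul_left_comm]
      exact mul_le_mul_of_nonneg_left (hpt ω) (hwn ω)
    have hP : 0 ≤ ∑ ω, weight q ω * (F ∅ * ind (sD Γ U s X) ω) :=
      Finset.sum_nonneg fun ω _ => mul_nonneg (hwn ω) (mul_nonneg (hF0 _) (ind_nonneg _ _))
    calc (∑ ω, weight q ω * (F ∅ * ind (sD Γ U s X) ω)) *
          (∑ ω, weight q ω * (G (sC Γ U s ω) * ind (sD Γ U s Y) ω))
        = (∑ ω, weight q ω * ind (sD Γ U s X) ω) *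
          (F ∅ * ∑ ω, weight q ω * (G (sC Γ U s ω) * ind (sD Γ U s Y) ω)) := by
          have : ∑ ω, weight q ω * (F ∅ * ind (sD Γ U s X) ω) = F ∅ * ∑ ω, weight q ω * ind (sD Γ U s X) ω := by
            rw [Finset.mul_sum]; refine Finset.sum_congr rfl fun ω _ => by ring
          rw [this]; ring
      _ ≤ (∑ ω, weight q ω * ind (sD Γ U s X) ω) *
          ∑ ω, weight q ω * (F (sC Γ U s ω) * G (sC Γ U s ω) * ind (sD Γ U s (X ∩ Y)) ω) :=
          mul_le_mul_of_nonneg_left hsum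
            (Finset.sum_nonneg fun ω _ => mul_nonneg (hwn ω) (ind_nonneg _ _))
      _ = _ := by ring
  by_cases hsY : s ∈ Y
  · have hXY : ∀ ω, ind (sD Γ U s (X ∪ Y)) ω = ind (sD Γ U s Y) ω := fun ω => by
      by_cases h : s ∈ ω
      · rw [ind_of_not_mem (fun h' => (mem_sD_iff_notMem hsU (Or.inr hsY) ω).1 h' h),
          ind_of_not_mem (fun h' => (mem_sD_iff_notMem hsU hsY ω).1 h' h)]
      · rw [ind_of_mem ((mem_sD_iff_notMem hsU (Or.inr hsY) ω).2 h),
          ind_of_mem ((mem_sD_iff_notMem hsU hsY ω).2 h)]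
    have hG1 : ∀ ω, G (sC Γ U s ω) * ind (sD Γ U s Y) ω = G ∅ * ind (sD Γ U s Y) ω := fun ω => by
      by_cases h : s ∈ ω
      · rw [ind_of_not_mem (fun h' => (mem_sD_iff_notMem hsU hsY ω).1 h' h), mul_zero, mul_zero]
      · rw [sC_eq_empty_of_notMem h]
    have hpt : ∀ ω, G ∅ * (F (sC Γ U s ω) * ind (sD Γ U s X) ω) ≤
        F (sC Γ U s ω) * G (sC Γ U s ω) * ind (sD Γ U s (X ∩ Y)) ω := fun ω => by
      have h1 : G ∅ ≤ G (sC Γ U s ω) := hG (Set.empty_subset _)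
      have h2 : ind (sD Γ U s X) ω ≤ ind (sD Γ U s (X ∩ Y)) ω :=
        ind_mono (sD_antitone Set.inter_subset_left) ω
      calc G ∅ * (F (sC Γ U s ω) * ind (sD Γ U s X) ω)
          ≤ G (sC Γ U s ω) * (F (sC Γ U s ω) * ind (sD Γ U s (X ∩ Y)) ω) :=
            mul_le_mul h1 (mul_le_mul_of_nonneg_left h2 (hF0 _))
              (mul_nonneg (hF0 _) (ind_nonneg _ _)) (hG0 _)
        _ = _ := by ring
    simp_rw [hXY, hG1]
    have hsum : G ∅ * ∑ ω, weight q ω * (F (sC Γ U s ω) * ind (sD Γ U s X) ω) ≤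
        ∑ ω, weight q ω * (F (sC Γ U s ω) * G (sC Γ U s ω) * ind (sD Γ U s (X ∩ Y)) ω) := by
      rw [Finset.mul_sum]
      refine Finset.sum_le_sum fun ω _ => ?_
      rw [mul_left_comm]
      exact mul_le_mul_of_nonneg_left (hpt ω) (hwn ω)
    calc (∑ ω, weight q ω * (F (sC Γ U s ω) * ind (sD Γ U s X) ω)) *
          (∑ ω, weight q ω * (G ∅ * ind (sD Γ U s Y) ω))
        = (G ∅ * ∑ ω, weight q ω * (F (sC Γ U s ω) * ind (sD Γ U s X) ω)) *
          (∑ ω, weight q ω * ind (sD Γ U s Y) ω) := by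
          have : ∑ ω, weight q ω * (G ∅ * ind (sD Γ U s Y) ω) = G ∅ * ∑ ω, weight q ω * ind (sD Γ U s Y) ω := by
            rw [Finset.mul_sum]; refine Finset.sum_congr rfl fun ω _ => by ring
          rw [this]; ring
      _ ≤ (∑ ω, weight q ω * (F (sC Γ U s ω) * G (sC Γ U s ω) * ind (sD Γ U s (X ∩ Y)) ω)) *
          (∑ ω, weight q ω * ind (sD Γ U s Y) ω) :=
          mul_le_mul_of_nonneg_right hsum
            (Finset.sum_nonneg fun ω _ => mul_nonneg (hwn ω) (ind_nonneg _ _))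
  -- `Z := X ∩ Y`
  set Z : Finset V := U.filter fun v => v ∈ X ∧ v ∈ Y with hZ
  have hZU : Z ⊆ U := Finset.filter_subset _ _
  have hmemZ : ∀ v, v ∈ Z ↔ v ∈ X ∧ v ∈ Y := fun v => by
    simp only [hZ, Finset.mem_filter, and_iff_right_iff_imp]
    exact fun h => hXU h.1
  have hsZ : s ∉ Z := fun h => hsX ((hmemZ s).1 h).1
  rcases Z.eq_empty_or_nonempty with hZe | hZne
  · /- `X ∩ Y = ∅`: two applications of Harris. -/
    have hXY : ∀ ω, ind (sD Γ U s (X ∩ Y)) ω = 1 := fun ω =>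
      ind_of_mem fun x hx _ => by
        have : x ∈ Z := (hmemZ x).2 hx
        rw [hZe] at this
        exact absurd this (Finset.notMem_empty x)
    have hXuY : ∀ ω, ind (sD Γ U s (X ∪ Y)) ω = ind (sD Γ U s X) ω * ind (sD Γ U s Y) ω := fun ω => by
      rw [sD_union, ind_inter]
    simp_rw [hXY, mul_one, hXuY]
    have hFm : Monotone fun ω => F (sC Γ U s ω) := fun a b hab => hF (sC_mono U s hab)
    have hGm : Monotone fun ω => G (sC Γ U s ω) := fun a b hab => hG (sC_mono U s hab)
    have h1 : ∑ ω, weight q ω * (F (sC Γ U s ω) * ind (sD Γ U s X) ω) ≤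
        (∑ ω, weight q ω * F (sC Γ U s ω)) * ∑ ω, weight q ω * ind (sD Γ U s X) ω :=
      harris_mono_anti hq0 hq1 hm (fun _ => hF0 _) hFm (ind_sD_antitone U s X) (fun _ => ind_le_one _ _)
    have h2 : ∑ ω, weight q ω * (G (sC Γ U s ω) * ind (sD Γ U s Y) ω) ≤
        (∑ ω, weight q ω * G (sC Γ U s ω)) * ∑ ω, weight q ω * ind (sD Γ U s Y) ω :=
      harris_mono_anti hq0 hq1 hm (fun _ => hG0 _) hGm (ind_sD_antitone U s Y) (fun _ => ind_le_one _ _)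
    have h3 : (∑ ω, weight q ω * F (sC Γ U s ω)) * (∑ ω, weight q ω * G (sC Γ U s ω)) ≤
        ∑ ω, weight q ω * (F (sC Γ U s ω) * G (sC Γ U s ω)) := by
      have := harris hq0 hq1 (fun _ => hF0 _) (fun _ => hG0 _) hFm hGm
      rwa [hm, one_mul] at this
    have h4 : (∑ ω, weight q ω * ind (sD Γ U s X) ω) * (∑ ω, weight q ω * ind (sD Γ U s Y) ω) ≤
        ∑ ω, weight q ω * (ind (sD Γ U s X) ω * ind (sD Γ U s Y) ω) :=
      harris_anti_anti hq0 hq1 hm (ind_sD_antitone U s X) (ind_sD_antitone U s Y)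
        (fun _ => ind_le_one _ _) (fun _ => ind_le_one _ _)
    have hFn : 0 ≤ ∑ ω, weight q ω * F (sC Γ U s ω) :=
      Finset.sum_nonneg fun ω _ => mul_nonneg (hwn ω) (hF0 _)
    have hXn : 0 ≤ ∑ ω, weight q ω * ind (sD Γ U s X) ω :=
      Finset.sum_nonneg fun ω _ => mul_nonneg (hwn ω) (ind_nonneg _ _)
    have hYn : 0 ≤ ∑ ω, weight q ω * ind (sD Γ U s Y) ω :=
      Finset.sum_nonneg fun ω _ => mul_nonneg (hwn ω) (ind_nonneg _ _)
    calc (∑ ω, weight q ω * (F (sC Γ U s ω) * ind (sD Γ U s X) ω)) *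
          (∑ ω, weight q ω * (G (sC Γ U s ω) * ind (sD Γ U s Y) ω))
        ≤ ((∑ ω, weight q ω * F (sC Γ U s ω)) * ∑ ω, weight q ω * ind (sD Γ U s X) ω) *
          ((∑ ω, weight q ω * G (sC Γ U s ω)) * ∑ ω, weight q ω * ind (sD Γ U s Y) ω) :=
          mul_le_mul h1 h2 (sum_ind_nonneg hq0 hq1 (fun _ => hG0 _) _) (mul_nonneg hFn hXn)
      _ = ((∑ ω, weight q ω * F (sC Γ U s ω)) * ∑ ω, weight q ω * G (sC Γ U s ω)) *
          ((∑ ω, weight q ω * ind (sD Γ U s X) ω) * ∑ ω, weight q ω * ind (sD Γ U s Y) ω) := by ring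
      _ ≤ (∑ ω, weight q ω * (F (sC Γ U s ω) * G (sC Γ U s ω))) *
          ∑ ω, weight q ω * (ind (sD Γ U s X) ω * ind (sD Γ U s Y) ω) :=
          mul_le_mul h3 h4 (mul_nonneg hXn hYn)
            (Finset.sum_nonneg fun ω _ => mul_nonneg (hwn ω) (mul_nonneg (hF0 _) (hG0 _)))
  · /- `Z ≠ ∅`: condition on the states of `Z` and apply the four functions theorem with the
    induction hypothesis on `U ∖ Z`. -/
    have hss : U \ Z ⊂ U := Finset.sdiff_ssubset hZU hZne
    have hsU' : s ∈ U \ Z := Finset.mem_sdiff.2 ⟨hsU, hsZ⟩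
    have hZX : (↑Z : Set V) ⊆ X := fun v hv => ((hmemZ v).1 hv).1
    have hZY : (↑Z : Set V) ⊆ Y := fun v hv => ((hmemZ v).1 hv).2
    have hZXY : (↑Z : Set V) ⊆ X ∩ Y := fun v hv => (hmemZ v).1 hv
    have hZXuY : (↑Z : Set V) ⊆ X ∪ Y := fun v hv => Or.inl (((hmemZ v).1 hv).1)
    have e1 := step_sum (Γ := Γ) hZU hsZ hZX q hm F
    have e2 := step_sum (Γ := Γ) hZU hsZ hZY q hm G
    have e3 : ∑ ω, weight q ω * (F (sC Γ U s ω) * G (sC Γ U s ω) * ind (sD Γ U s (X ∩ Y)) ω) =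
        ∑ ω, weight q ω * blockE Γ q (U \ Z) s (fun a => F a * G a) ((X ∩ Y) \ ↑Z) (sS Γ U Z ω) :=
      step_sum (Γ := Γ) hZU hsZ hZXY q hm (fun a => F a * G a)
    have e4 : ∑ ω, weight q ω * ind (sD Γ U s (X ∪ Y)) ω =
        ∑ ω, weight q ω * blockE Γ q (U \ Z) s (fun _ => 1) ((X ∪ Y) \ ↑Z) (sS Γ U Z ω) := by
      have := step_sum (Γ := Γ) hZU hsZ hZXuY q hm (fun _ => 1)
      simpa only [one_mul] using this
    rw [e1, e2, e3, e4]
    refine four_functions_theorem_univ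
      (fun ω => weight q ω * blockE Γ q (U \ Z) s F (X \ ↑Z) (sS Γ U Z ω))
      (fun ω => weight q ω * blockE Γ q (U \ Z) s G (Y \ ↑Z) (sS Γ U Z ω))
      (fun ω => weight q ω * blockE Γ q (U \ Z) s (fun a => F a * G a) ((X ∩ Y) \ ↑Z) (sS Γ U Z ω))
      (fun ω => weight q ω * blockE Γ q (U \ Z) s (fun _ => 1) ((X ∪ Y) \ ↑Z) (sS Γ U Z ω))
      (fun ω => mul_nonneg (hwn ω) (blockE_nonneg hq0 hq1 _ _ hF0 _ _))
      (fun ω => mul_nonneg (hwn ω) (blockE_nonneg hq0 hq1 _ _ hG0 _ _))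
      (fun ω => mul_nonneg (hwn ω)
        (blockE_nonneg hq0 hq1 _ _ (fun a => mul_nonneg (hF0 a) (hG0 a)) _ _))
      (fun ω => mul_nonneg (hwn ω) (blockE_nonneg hq0 hq1 _ _ (fun _ => zero_le_one) _ _))
      fun a b => ?_
    -- the Ahlswede–Daykin hypothesis: weight lattice identity × induction hypothesis
    set Sa := sS Γ U Z a with hSa
    set Sb := sS Γ U Z b with hSb
    have hSaU : Sa ⊆ ↑(U \ Z) := sS_subset U Z a
    have hSbU : Sb ⊆ ↑(U \ Z) := sS_subset U Z b
    have hX1 : X \ ↑Z ∪ Sa ⊆ ↑(U \ Z) := Set.union_subset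
      (fun v hv => by rw [Finset.coe_sdiff]; exact ⟨hXU hv.1, hv.2⟩) hSaU
    have hY1 : Y \ ↑Z ∪ Sb ⊆ ↑(U \ Z) := Set.union_subset
      (fun v hv => by rw [Finset.coe_sdiff]; exact ⟨hYU hv.1, hv.2⟩) hSbU
    have IH := ih (U \ Z) hss s hsU' (X \ ↑Z ∪ Sa) (Y \ ↑Z ∪ Sb) hX1 hY1 F G hF hG hF0 hG0
    have hsub3 : (X ∩ Y) \ ↑Z ∪ sS Γ U Z (a ∩ b) ⊆ (X \ ↑Z ∪ Sa) ∩ (Y \ ↑Z ∪ Sb) := by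
      refine Set.union_subset (fun v hv => ⟨Or.inl ⟨hv.1.1, hv.2⟩, Or.inl ⟨hv.1.2, hv.2⟩⟩) ?_
      exact fun v hv =>
        ⟨Or.inr (sS_inter_subset U Z a b hv).1, Or.inr (sS_inter_subset U Z a b hv).2⟩
    have hsub4 : (X ∪ Y) \ ↑Z ∪ sS Γ U Z (a ∪ b) ⊆ (X \ ↑Z ∪ Sa) ∪ (Y \ ↑Z ∪ Sb) := by
      rw [sS_union]
      rintro v (⟨hXY | hXY, hvZ⟩ | hS | hS)
      · exact Or.inl (Or.inl ⟨hXY, hvZ⟩)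
      · exact Or.inr (Or.inl ⟨hXY, hvZ⟩)
      · exact Or.inl (Or.inr hS)
      · exact Or.inr (Or.inr hS)
    have h3 : ∑ ω, weight q ω * (F (sC Γ (U \ Z) s ω) * G (sC Γ (U \ Z) s ω) *
        ind (sD Γ (U \ Z) s ((X \ ↑Z ∪ Sa) ∩ (Y \ ↑Z ∪ Sb))) ω) ≤
        blockE Γ q (U \ Z) s (fun a => F a * G a) ((X ∩ Y) \ ↑Z) (sS Γ U Z (a ∩ b)) :=
      sum_ind_mono hq0 hq1 (fun ω => mul_nonneg (hF0 _) (hG0 _)) (sD_antitone hsub3)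
    have h4 : ∑ ω, weight q ω * ind (sD Γ (U \ Z) s ((X \ ↑Z ∪ Sa) ∪ (Y \ ↑Z ∪ Sb))) ω ≤
        blockE Γ q (U \ Z) s (fun _ => 1) ((X ∪ Y) \ ↑Z) (sS Γ U Z (a ∪ b)) := by
      have := sum_ind_mono hq0 hq1 (h := fun _ => (1 : ℝ)) (fun _ => zero_le_one)
        (sD_antitone (Γ := Γ) (U := U \ Z) (s := s) hsub4) (w := q)
      simp only [one_mul] at this
      simpa only [blockE, one_mul] using this
    have hIH' : blockE Γ q (U \ Z) s F (X \ ↑Z) Sa * blockE Γ q (U \ Z) s G (Y \ ↑Z) Sb ≤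
        blockE Γ q (U \ Z) s (fun a => F a * G a) ((X ∩ Y) \ ↑Z) (sS Γ U Z (a ∩ b)) *
          blockE Γ q (U \ Z) s (fun _ => 1) ((X ∪ Y) \ ↑Z) (sS Γ U Z (a ∪ b)) :=
      IH.trans (mul_le_mul h3 h4 (Finset.sum_nonneg fun ω _ => mul_nonneg (hwn ω) (ind_nonneg _ _))
        (blockE_nonneg hq0 hq1 _ _ (fun a => mul_nonneg (hF0 a) (hG0 a)) _ _))
    have hwab := weight_inter_mul_union q a b
    show weight q a * blockE Γ q (U \ Z) s F (X \ ↑Z) Sa *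
        (weight q b * blockE Γ q (U \ Z) s G (Y \ ↑Z) Sb) ≤
      weight q (a ∩ b) * blockE Γ q (U \ Z) s (fun a => F a * G a) ((X ∩ Y) \ ↑Z) (sS Γ U Z (a ∩ b)) *
        (weight q (a ∪ b) * blockE Γ q (U \ Z) s (fun _ => 1) ((X ∪ Y) \ ↑Z) (sS Γ U Z (a ∪ b)))
    calc weight q a * blockE Γ q (U \ Z) s F (X \ ↑Z) Sa *
          (weight q b * blockE Γ q (U \ Z) s G (Y \ ↑Z) Sb)
        = (weight q a * weight q b) *
          (blockE Γ q (U \ Z) s F (X \ ↑Z) Sa * blockE Γ q (U \ Z) s G (Y \ ↑Z) Sb) := by ring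
      _ ≤ (weight q (a ∩ b) * weight q (a ∪ b)) *
          (blockE Γ q (U \ Z) s (fun a => F a * G a) ((X ∩ Y) \ ↑Z) (sS Γ U Z (a ∩ b)) *
            blockE Γ q (U \ Z) s (fun _ => 1) ((X ∪ Y) \ ↑Z) (sS Γ U Z (a ∪ b))) := by
          rw [hwab]
          exact mul_le_mul_of_nonneg_left hIH' (mul_nonneg (hwn _) (hwn _))
      _ = _ := by ring


end SiteBHK

end Summit.CriticalPhenomena.PercolationContinuityZ3.Theorems.Transplant
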